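import Mathlib
import HarnessLib
import Summits.HubbardSuperconductivity.HubbardSuperconductivity.Theorems.KLProgrammeKLRegimeTwoVolumeTowerStepCovSliceIncrSymbol
import Summits.HubbardSuperconductivity.HubbardSuperconductivity.Theorems.KLProgrammeKLRegimeTwoVolumeTowerStepCovZeroIncrL1

/-!
# K3 VL child (stmt-HubbardSuperconductivity-20440), (G1) re-blocking support, part B: the ISOTROPIC moment-weighted `ℓ¹` norm of the slice-kernel INCREMENT
# `(βV²)⁻²·(Ψ̂_{(Λ,Λ′]}[K′] − Ψ̂_{(Λ,Λ′]}[K])` for a GENERIC slice `0 < Λ ≤ Λ′ ≤ Λ₁` — the d-free twin of p3 g17's `incrSlice_wt_l1_le` (there `(Λ,Λ′) = (Λ₂,Λ₁)`)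

Cell `gate-hubbard-kl`, seat p3 (g19).  **`incrSliceGen_wt_l1_le`** — for `0 < Λ ≤ Λ′ ≤ Λ₁`: `∃ C_d, s_d > 0` (`s_d ≤ 1`; depending on `Λ, Λ′, K₃ˢ`
and the cutoff numerals) such that on any lattice `(V, M)`, at any two admissible frames in the two-scale class `(G₀, x)` of part A, for `klBetaMin ≤ β ≤ M`:
`Σ_z (1 + (s_d/x)|z̃₂,₁| + (s_d/x)|z̃₂,₂|)·‖Σ_q χ_{q₁}(z₁)χ_{q₂}(z₂) • (βV²)⁻²(Ψ̂_{(Λ,Λ′]}[K′] − Ψ̂_{(Λ,Λ′]}[K])(q)‖ ≤ C_d·(M/β)·(G₀/x)`.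
VERBATIM g17's proof with the generic pointwise data of part A and the support count `card_support_sliceSymbolTorusIncr_le` at `(Λ, Λ′)`.
Consumers: the block-0 two-frame mismatch of the re-blocked VL tower (slice `(Λ_{d+1}, Λ₁]`, constant multiplier; rows via g17's
`rowSumWt_pullback_one_le` at any weight ≥ the decay weight); E1's re-blocked scale-0 rows.

Everything is proved; no definitions, no sorry.  Nothing asserts any stub, K3, VL or superconductivity.
[cite: BenfattoGiulianiMastropietro2006, Lemma 2.2 (2.52), §2.7 (2.66)–(2.67), §2.8 (2.80)–(2.81), §3 (3.2)–(3.8)]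
-/

noncomputable section

namespace Summit.HubbardSuperconductivity.HubbardSuperconductivity.Theorems.TorusFourierL2

set_option linter.dupNamespace false -- summit = problem name (single-conjunct summit), D-0017

open Set Finset Literature.MathematicalPhysics.QuantumLattice Literature.MathematicalPhysics.QuantumLattice.BandSectorCounting
open Literature.MathematicalPhysics.QuantumLattice.FermiRG Literature.Probability.LatticeModels Literature.Analysis.SpecialFunctions
open Summit.HubbardSuperconductivity.HubbardSuperconductivity.Theorems.DispersionFlow
open Summit.HubbardSuperconductivity.HubbardSuperconductivity.Theorems.KLRegimeSplit
open Summit.HubbardSuperconductivity.HubbardSuperconductivity.Theorems.KLProgrammeLegKernels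
open Summit.HubbardSuperconductivity.HubbardSuperconductivity.Theorems.PerturbedFermiCurve
open Summit.HubbardSuperconductivity.HubbardSuperconductivity.Theorems.KLRegimeWick
open Summit.HubbardSuperconductivity.HubbardSuperconductivity.Theorems.TwoVolumeSource
open scoped Real Nat

open Classical

/-! ## §1 The weighted `ℓ¹` bound of the two-frame increment on a generic slice -/

set_option maxHeartbeats 4000000 in -- explicit-constant bookkeeping against the large master lemma (as in g17's `incrSlice_wt_l1_le`)
/-- **THE ISOTROPIC WEIGHTED `ℓ¹` NORM OF THE SLICE-KERNEL INCREMENT ON A GENERIC SLICE `(Λ, Λ′]`** (see the module docstring).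
[cite: BenfattoGiulianiMastropietro2006, Lemma 2.2 (2.52), §2.8 (2.80)–(2.81), §3 (3.2)–(3.8)] -/
theorem incrSliceGen_wt_l1_le {Λ Λ' : ℝ} (hΛ2 : 0 < Λ) (hΛ21 : Λ ≤ Λ') (hΛ'1 : Λ' ≤ klScale klE0 1) (K₃s : ℝ) (hK₃s : 0 ≤ K₃s) :
    ∃ Cd sd : ℝ, 0 < Cd ∧ 0 < sd ∧ sd ≤ 1 ∧
      ∀ (V M : ℕ) [NeZero V] [NeZero M] (R : RenConsts) (U : ℝ) (N : ℕ) (R' : RenConsts) (U' : ℝ) (N' : ℕ) (μ : ℝ) (K K' : TrigPolyC4v),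
      FrameOK R U N μ K → FrameOK R' U' N' μ K' →
      ∀ (G₀ x : ℝ), 0 ≤ G₀ → G₀ ≤ 1 → 1 ≤ x →
      (∀ p, ‖iteratedFDeriv ℝ 3 (frameLevel μ K) p‖ ≤ K₃s * x) →
      (∀ p, |frameLevel μ K' p - frameLevel μ K p| ≤ G₀ / x ^ 2) →
      (∀ p, ‖fderiv ℝ (fun p => frameLevel μ K' p - frameLevel μ K p) p‖ ≤ G₀ / x) →
      (∀ p, ‖iteratedFDeriv ℝ 2 (fun p => frameLevel μ K' p - frameLevel μ K p) p‖ ≤ G₀) →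
      (∀ p, ‖iteratedFDeriv ℝ 3 (fun p => frameLevel μ K' p - frameLevel μ K p) p‖ ≤ G₀ * x) →
      ∀ β : ℝ, klBetaMin ≤ β → β ≤ (M : ℝ) →
        ∑ z : TorusSite 1 (2 * M) × TorusSite 2 V,
          (1 + sd / x * |(((z.2 0).valMinAbs : ℤ) : ℝ)| + sd / x * |(((z.2 1).valMinAbs : ℤ) : ℝ)|) *
            ‖∑ q : TorusSite 1 (2 * M) × TorusSite 2 V, (torusChar q.1 z.1 * torusChar q.2 z.2) •
              ((((1 / (β * (V : ℝ) ^ 2) : ℝ) : ℂ) ^ 2 *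
                (sliceSymbolFnXi (β * (V : ℝ) ^ 2) 0 (Λ) (Λ') (matsubaraFreq β M ⟨(q.1 0).val, ZMod.val_lt (q.1 0)⟩)
                    (nambuXiCT V μ K' q.2) -
                  sliceSymbolFnXi (β * (V : ℝ) ^ 2) 0 (Λ) (Λ') (matsubaraFreq β M ⟨(q.1 0).val, ZMod.val_lt (q.1 0)⟩)
                    (nambuXiCT V μ K q.2))))‖ ≤ Cd * ((M : ℝ) / β) * (G₀ / x) := by
  -- the cutoff numerals and the slice constants
  set D₁ : ℝ := 16 * (32 / 3 : ℝ) + 16 with hD₁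
  set D₂ : ℝ := 32 * (448 / 3 * Real.exp 2) + 144 * (32 / 3 : ℝ) + 128 with hD₂
  set D₃ : ℝ := 64 * (44900 : ℝ) + 480 * (448 / 3 * Real.exp 2) + 1728 * (32 / 3 : ℝ) + 1536 with hD₃
  set D₄ : ℝ := 128 * (3960000 : ℝ) + 1408 * 44900 + 7776 * (448 / 3 * Real.exp 2) + 27648 * (32 / 3 : ℝ) + 24576 with hD₄
  set Dt : ℝ := 128 * (3960000 : ℝ) + 1216 * 44900 + 6912 * (448 / 3 * Real.exp 2) + 26112 * (32 / 3 : ℝ) + 24576 with hDt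
  have hD₁0 : 0 < D₁ := by rw [hD₁]; norm_num
  have hD₁1 : 1 ≤ D₁ := by rw [hD₁]; norm_num
  have hD₂0 : 0 < D₂ := by rw [hD₂]; positivity
  have hD₃0 : 0 < D₃ := by rw [hD₃]; positivity
  have hD₄0 : 0 < D₄ := by rw [hD₄]; positivity
  have hDt0 : 0 < Dt := by rw [hDt]; positivity
  have hDt1 : 1 ≤ Dt := by rw [hDt]; have := Real.exp_pos 2; nlinarith
  have he : (0 : ℝ) < klE0 := by norm_num [klE0]
  set Λ₂ : ℝ := Λ with hΛ₂def
  set Λ₁ : ℝ := Λ' with hΛ₁def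
  have hΛ1 : 0 < Λ₁ := lt_of_lt_of_le hΛ2 hΛ21
  have hΛ1t : Λ₁ < 3 / 80 := lt_of_le_of_lt hΛ'1 (klScale_klE0_lt_tube 1)
  have hΛ2t : Λ₂ < 3 / 80 := lt_of_le_of_lt hΛ21 hΛ1t
  have hΛ2sq : Λ₂ ^ 2 ≤ 1 := by nlinarith
  have hπ := Real.pi_pos
  -- the jet polynomials of part 3a and the spatial rate
  set Y₂ : ℝ := 64 * D₃ / Λ₂ ^ 4 + 23 * D₂ / Λ₂ ^ 3 + D₁ / Λ₂ ^ 2 with hY₂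
  set Y₃ : ℝ := 512 * D₄ / Λ₂ ^ 5 + 361 * D₃ / Λ₂ ^ 4 + (45 + (K₃s + 1)) * D₂ / Λ₂ ^ 3 + D₁ / Λ₂ ^ 2 with hY₃
  set Y : ℝ := Y₂ + Y₃ with hY
  have hY₂0 : 0 ≤ Y₂ := by rw [hY₂]; positivity
  have hY₃0 : 0 ≤ Y₃ := by rw [hY₃]; positivity
  have hY0 : 0 ≤ Y := by rw [hY]; positivity
  set sd : ℝ := 1 / (2 * π * (1 + Y)) with hsd
  have hsd0 : 0 < sd := by rw [hsd]; positivity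
  have hsd1 : sd ≤ 1 := by
    rw [hsd, div_le_one (by positivity)]
    nlinarith [Real.pi_gt_three]
  -- the time-rate constant and the final constant
  set κ₀ : ℝ := Λ₂ / (2 * π * Dt) with hκ₀
  have hκ₀0 : 0 < κ₀ := by rw [hκ₀]; positivity
  set CW : ℝ := 32768 * (1 / κ₀ + 1) *
      ((1 + 4 * Real.sqrt 2) ^ 2 * (4 * ((2 * Real.sqrt 2 / sd + 2) * (2 * Real.sqrt 2 / sd + 2))) + 16 * (1 / sd + 1) ^ 2) with hCW
  set CN : ℝ := 84 * (Λ₁ / π + 3 / 128) * (1793 * Λ₁ + 704) with hCN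
  have hCW0 : 0 < CW := by rw [hCW]; positivity
  have hCN0 : 0 < CN := by rw [hCN]; positivity
  refine ⟨Real.sqrt CW * Real.sqrt CN * (D₁ / Λ₂ ^ 2), sd, by positivity, hsd0, hsd1, ?_⟩
  intro V M _ _ R U N R' U' N' μ K K' hK hK' G₀ x hG hG1 hx hK3 hv₀ hv₁ hv₂ hv₃ β hβmin hβM
  -- the instance
  have hβ0 : 0 < β := pos_of_klBetaMin_le hβmin
  have hβ128 : (128 : ℝ) ≤ β := by simpa [klBetaMin] using hβmin
  have hV1 : (1 : ℝ) ≤ V := by exact_mod_cast Nat.pos_of_ne_zero (NeZero.ne V)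
  have hV0 : (0 : ℝ) < V := by linarith
  have hM0 : (0 : ℝ) < M := lt_of_lt_of_le hβ0 hβM
  have hMβ : 1 ≤ (M : ℝ) / β := by rw [le_div_iff₀ hβ0, one_mul]; exact hβM
  have hc : 0 < β * (V : ℝ) ^ 2 := by positivity
  have hx0 : 0 < x := by linarith
  obtain ⟨hre, hrn, hrv, hv⟩ := unitDirs_sq
  -- abbreviations
  set c₀ : ℂ := (((1 / (β * (V : ℝ) ^ 2) : ℝ) : ℂ)) ^ 2 with hc₀def
  set Ψ : TorusSite 1 (2 * M) × TorusSite 2 V → ℂ := fun q =>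
    sliceSymbolFnXi (β * (V : ℝ) ^ 2) 0 Λ₂ Λ₁ (matsubaraFreq β M ⟨(q.1 0).val, ZMod.val_lt (q.1 0)⟩) (nambuXiCT V μ K' q.2) -
      sliceSymbolFnXi (β * (V : ℝ) ^ 2) 0 Λ₂ Λ₁ (matsubaraFreq β M ⟨(q.1 0).val, ZMod.val_lt (q.1 0)⟩) (nambuXiCT V μ K q.2) with hΨdef
  set A₀ : ℝ := (1 / (β * (V : ℝ) ^ 2)) ^ 2 * (D₁ * (β * (V : ℝ) ^ 2) / Λ₂ ^ 2 * (G₀ / x ^ 2)) with hA₀def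
  have hA₀0 : 0 ≤ A₀ := by positivity
  have hA₀eq : A₀ = D₁ * G₀ / (β * (V : ℝ) ^ 2 * Λ₂ ^ 2 * x ^ 2) := by rw [hA₀def]; field_simp
  set s₁ : ℝ := sd / x with hs₁def
  have hs₁0 : 0 < s₁ := by positivity
  set s₀ : ℝ := κ₀ * β / M with hs₀def
  have hs₀0 : 0 < s₀ := by positivity
  -- (a) sup
  have hsup : ∀ q, ‖c₀ * Ψ q‖ ≤ A₀ := fun q => by
    have h := incrSliceSymbol_sup_le (V := V) (M := M) (μ := μ) (K := K) (K' := K') hΛ2 hΛ21 hβ0 hv₀ q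
    rw [← hD₁] at h
    exact h
  -- (b) rate identities
  have hsV3 : (4 / (s₁ * V)) ^ 3 = (2 * π / V) ^ 3 * (64 * (1 + Y) ^ 3 * x ^ 3) := by
    rw [hs₁def, hsd]; field_simp; ring
  have key3 : Y₃ * Λ₂ ^ 2 ≤ 64 * D₁ * (1 + Y) ^ 3 := by
    have h1 : Y₃ * Λ₂ ^ 2 ≤ Y₃ := mul_le_of_le_one_right hY₃0 hΛ2sq
    have h2 : Y₃ ≤ 1 + Y := by rw [hY]; linarith
    have h3 : (1 : ℝ) ≤ 1 + Y := by linarith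
    have h4 : 1 + Y ≤ (1 + Y) ^ 3 := le_self_pow₀ h3 (by norm_num)
    have h5 : (1 + Y) ^ 3 ≤ 64 * D₁ * (1 + Y) ^ 3 := le_mul_of_one_le_left (by positivity) (by linarith)
    linarith
  -- (c) the spatial third-difference inputs and the time input
  have hspace3 : ∀ r : Fin 2 → ℤ, (r 0 : ℝ) ^ 2 + (r 1 : ℝ) ^ 2 = 1 → ∀ q,
      ‖((fwdDiff ((0 : TorusSite 1 (2 * M)), (fun i => ((r i : ℤ) : ZMod V))))^[3] (fun y => c₀ * Ψ y)) q‖ ≤ A₀ * (4 / (s₁ * V)) ^ 3 := by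
    intro r hr q
    refine (incrSliceSymbol_three_space_le (V := V) (M := M) hΛ2 hΛ21 hK hβ0 hG hG1 hx hK₃s hK3 hv₀ hv₁ hv₂ hv₃ r hr q).trans ?_
    conv_rhs => rw [hA₀def, mul_assoc]
    refine mul_le_mul_of_nonneg_left ?_ (by positivity)
    rw [← hD₄, ← hD₃, ← hD₂, ← hD₁, ← hY₃, hsV3]
    have h : β * (V : ℝ) ^ 2 * (2 * π / V) ^ 3 * (G₀ * x) * Y₃ =
        (β * (V : ℝ) ^ 2 * (2 * π / V) ^ 3 * (G₀ * x) / Λ₂ ^ 2) * (Y₃ * Λ₂ ^ 2) := by field_simp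
    rw [h]
    have h' : D₁ * (β * (V : ℝ) ^ 2) / Λ₂ ^ 2 * (G₀ / x ^ 2) * ((2 * π / V) ^ 3 * (64 * (1 + Y) ^ 3 * x ^ 3)) =
        (β * (V : ℝ) ^ 2 * (2 * π / V) ^ 3 * (G₀ * x) / Λ₂ ^ 2) * (64 * D₁ * (1 + Y) ^ 3) := by field_simp
    rw [h']
    exact mul_le_mul_of_nonneg_left key3 (by positivity)
  have htime : ∀ q, ‖((fwdDiff ((fun _ : Fin 1 => (1 : ZMod (2 * M))), (0 : TorusSite 2 V)))^[3] (fun y => c₀ * Ψ y)) q‖ ≤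
      A₀ * (4 / (s₀ * ((2 * M : ℕ) : ℝ))) ^ 3 := by
    intro q
    refine (incrSliceSymbol_three_time_le (V := V) (M := M) (K := K) (K' := K') hΛ2 hΛ21 hΛ'1 hβmin hβM hv₀ q).trans ?_
    conv_rhs => rw [hA₀def, mul_assoc]
    rw [← hDt]
    refine mul_le_mul_of_nonneg_left ?_ (by positivity)
    have e4 : 4 / (s₀ * ((2 * M : ℕ) : ℝ)) = 4 * π * Dt / (Λ₂ * β) := by
      rw [hs₀def, hκ₀]; push_cast; field_simp
    rw [e4]
    have lhs : (2 * π / β) ^ 3 * (Dt * (β * (V : ℝ) ^ 2) / Λ₂ ^ 5 * (G₀ / x ^ 2)) =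
        π ^ 3 * (β * (V : ℝ) ^ 2) * G₀ / (β ^ 3 * Λ₂ ^ 5 * x ^ 2) * (8 * Dt) := by
      field_simp; ring
    have rhs : D₁ * (β * (V : ℝ) ^ 2) / Λ₂ ^ 2 * (G₀ / x ^ 2) * (4 * π * Dt / (Λ₂ * β)) ^ 3 =
        π ^ 3 * (β * (V : ℝ) ^ 2) * G₀ / (β ^ 3 * Λ₂ ^ 5 * x ^ 2) * (64 * D₁ * Dt ^ 3) := by
      field_simp; ring
    rw [lhs, rhs]
    refine mul_le_mul_of_nonneg_left ?_ (by positivity)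
    exact numerals_eight_le hD₁1 hDt1
  -- (d) the support count
  have hsuppΨ := card_support_sliceSymbolTorusIncr_le (V := V) (M := M) hK hK' hβ0 (β * (V : ℝ) ^ 2) hΛ2 hΛ21 hΛ1t
  have hsub : ((univ : Finset (TorusSite 1 (2 * M) × TorusSite 2 V)).filter fun q => c₀ * Ψ q ≠ 0) ⊆
      (univ : Finset (TorusSite 1 (2 * M) × TorusSite 2 V)).filter fun q =>
        sliceSymbolFnXi (β * (V : ℝ) ^ 2) 0 Λ₂ Λ₁ (matsubaraFreq β M ⟨(q.1 0).val, ZMod.val_lt (q.1 0)⟩) (nambuXiCT V μ K' q.2) -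
          sliceSymbolFnXi (β * (V : ℝ) ^ 2) 0 Λ₂ Λ₁ (matsubaraFreq β M ⟨(q.1 0).val, ZMod.val_lt (q.1 0)⟩) (nambuXiCT V μ K q.2) ≠ 0 := by
    intro q hq
    rw [mem_filter] at hq ⊢
    exact ⟨hq.1, fun h => hq.2 (by simp only [hΨdef]; rw [h, mul_zero])⟩
  have hNs : ((((univ : Finset (TorusSite 1 (2 * M) × TorusSite 2 V)).filter fun q => c₀ * Ψ q ≠ 0).card : ℕ) : ℝ) ≤
      β * (V : ℝ) ^ 2 * (2 * ((Λ₁ / π + 3 / 128) * (1793 * Λ₁ + 704))) := by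
    refine le_trans (Nat.cast_le.2 (Finset.card_le_card hsub)) (hsuppΨ.trans ?_)
    have h1 : Λ₁ * β / π + 3 ≤ β * (Λ₁ / π + 3 / 128) := by
      rw [mul_add]
      have : (3 : ℝ) ≤ β * (3 / 128) := by linarith
      have e : Λ₁ * β / π = β * (Λ₁ / π) := by ring
      linarith
    have hVV : (V : ℝ) ≤ (V : ℝ) ^ 2 := le_self_pow₀ hV1 (by norm_num)
    have h2 : 1793 * Λ₁ * (V : ℝ) ^ 2 + 704 * V ≤ (V : ℝ) ^ 2 * (1793 * Λ₁ + 704) := by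
      have e : (V : ℝ) ^ 2 * (1793 * Λ₁ + 704) = 1793 * Λ₁ * (V : ℝ) ^ 2 + 704 * (V : ℝ) ^ 2 := by ring
      rw [e]; linarith
    calc 2 * ((Λ₁ * β / π + 3) * (1793 * Λ₁ * (V : ℝ) ^ 2 + 704 * V)) ≤ 2 * ((β * (Λ₁ / π + 3 / 128)) * ((V : ℝ) ^ 2 * (1793 * Λ₁ + 704))) := by
          gcongr
      _ = _ := by ring
  -- (e) the master lemma, then drop the time moment and evaluate the constant
  have main := sum_wt_norm_charSum_le_of_third_differences (fun q => c₀ * Ψ q) (![0, 1] : Fin 2 → ℤ) hv hs₀0 hs₁0 hs₁0 hs₁0 (R₀ := 0)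
    (by push_cast; rw [mul_zero]; exact_mod_cast Nat.pos_of_ne_zero (NeZero.ne V)) hA₀0 le_rfl hsup htime
    (fun q i => by rw [pi_single_zmod_eq_intCast V i]; exact hspace3 _ (hre i) q) (fun q => hspace3 _ hrn q) (fun q => hspace3 _ hrv q)
  refine le_trans (Finset.sum_le_sum fun z _ => mul_le_mul_of_nonneg_right ?_ (norm_nonneg _)) (main.trans ?_)
  · have : 0 ≤ s₀ * |(((z.1 0).valMinAbs : ℤ) : ℝ)| := by positivity
    simp only [hs₁def] at this ⊢
    linarith
  have hv0 : (((![0, 1] : Fin 2 → ℤ) 0 : ℤ) : ℝ) = 0 := by simp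
  have hv1 : (((![0, 1] : Fin 2 → ℤ) 1 : ℤ) : ℝ) = 1 := by simp
  rw [hv0, hv1]
  have hsq1 : Real.sqrt ((0 : ℝ) ^ 2 + (1 : ℝ) ^ 2) = 1 := by norm_num
  rw [hsq1]
  have es : 2 * Real.sqrt 2 * s₁ / (s₁ * 1) = 2 * Real.sqrt 2 := by field_simp
  rw [es, Nat.cast_zero, mul_zero, add_zero, div_one, mul_one]
  have e2 : (1 + 2 * Real.sqrt 2 + 2 * Real.sqrt 2) = 1 + 4 * Real.sqrt 2 := by ring
  rw [e2]
  -- the weight factor: `1/s₁ = x/sd`, `x ≥ 1`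
  have hW : 32768 * (1 / s₀ + 1) * ((1 + 4 * Real.sqrt 2) ^ 2 *
      (4 * ((2 * Real.sqrt 2 / s₁ + 2) * (2 * Real.sqrt 2 / s₁ + 2))) + 16 * (1 / s₁ + 1) ^ 2) ≤ (M : ℝ) / β * x ^ 2 * CW := by
    rw [hCW]
    have h1 : 1 / s₀ + 1 ≤ (M : ℝ) / β * (1 / κ₀ + 1) := by
      rw [hs₀def]
      have e : 1 / (κ₀ * β / (M : ℝ)) = (M : ℝ) / β * (1 / κ₀) := by field_simp
      rw [e]; linarith
    have h10 : 0 ≤ 1 / s₀ + 1 := by positivity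
    have ha : 2 * Real.sqrt 2 / s₁ + 2 ≤ x * (2 * Real.sqrt 2 / sd + 2) := by
      rw [hs₁def]
      have e : 2 * Real.sqrt 2 / (sd / x) = x * (2 * Real.sqrt 2 / sd) := by field_simp
      rw [e, mul_add]; linarith
    have ha0 : 0 ≤ 2 * Real.sqrt 2 / s₁ + 2 := by positivity
    have hb : 1 / s₁ + 1 ≤ x * (1 / sd + 1) := by
      rw [hs₁def]
      have e : 1 / (sd / x) = x * (1 / sd) := by field_simp
      rw [e, mul_add]; linarith
    have hb0 : 0 ≤ 1 / s₁ + 1 := by positivity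
    have hA : (2 * Real.sqrt 2 / s₁ + 2) * (2 * Real.sqrt 2 / s₁ + 2) ≤ x ^ 2 * ((2 * Real.sqrt 2 / sd + 2) * (2 * Real.sqrt 2 / sd + 2)) := by
      calc (2 * Real.sqrt 2 / s₁ + 2) * (2 * Real.sqrt 2 / s₁ + 2) ≤ (x * (2 * Real.sqrt 2 / sd + 2)) * (x * (2 * Real.sqrt 2 / sd + 2)) :=
            mul_le_mul ha ha ha0 (by positivity)
        _ = _ := by ring
    have hB : (1 / s₁ + 1) ^ 2 ≤ x ^ 2 * (1 / sd + 1) ^ 2 := by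
      calc (1 / s₁ + 1) ^ 2 ≤ (x * (1 / sd + 1)) ^ 2 := pow_le_pow_left₀ hb0 hb 2
        _ = _ := by ring
    have hBr : (1 + 4 * Real.sqrt 2) ^ 2 * (4 * ((2 * Real.sqrt 2 / s₁ + 2) * (2 * Real.sqrt 2 / s₁ + 2))) + 16 * (1 / s₁ + 1) ^ 2 ≤
        x ^ 2 * ((1 + 4 * Real.sqrt 2) ^ 2 * (4 * ((2 * Real.sqrt 2 / sd + 2) * (2 * Real.sqrt 2 / sd + 2))) + 16 * (1 / sd + 1) ^ 2) := by
      calc (1 + 4 * Real.sqrt 2) ^ 2 * (4 * ((2 * Real.sqrt 2 / s₁ + 2) * (2 * Real.sqrt 2 / s₁ + 2))) + 16 * (1 / s₁ + 1) ^ 2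
          ≤ (1 + 4 * Real.sqrt 2) ^ 2 * (4 * (x ^ 2 * ((2 * Real.sqrt 2 / sd + 2) * (2 * Real.sqrt 2 / sd + 2)))) + 16 * (x ^ 2 * (1 / sd + 1) ^ 2) :=
            add_le_add (mul_le_mul_of_nonneg_left (mul_le_mul_of_nonneg_left hA (by norm_num)) (by positivity))
              (mul_le_mul_of_nonneg_left hB (by norm_num))
        _ = _ := by ring
    have hBr0 : 0 ≤ (1 + 4 * Real.sqrt 2) ^ 2 * (4 * ((2 * Real.sqrt 2 / s₁ + 2) * (2 * Real.sqrt 2 / s₁ + 2))) + 16 * (1 / s₁ + 1) ^ 2 := by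
      positivity
    calc 32768 * (1 / s₀ + 1) * ((1 + 4 * Real.sqrt 2) ^ 2 * (4 * ((2 * Real.sqrt 2 / s₁ + 2) * (2 * Real.sqrt 2 / s₁ + 2))) + 16 * (1 / s₁ + 1) ^ 2)
        ≤ 32768 * ((M : ℝ) / β * (1 / κ₀ + 1)) *
          (x ^ 2 * ((1 + 4 * Real.sqrt 2) ^ 2 * (4 * ((2 * Real.sqrt 2 / sd + 2) * (2 * Real.sqrt 2 / sd + 2))) + 16 * (1 / sd + 1) ^ 2)) := by
          gcongr
      _ = _ := by ring
  have hN : 21 * ((2 * M : ℕ) : ℝ) * (V : ℝ) ^ 2 * ((((univ : Finset (TorusSite 1 (2 * M) × TorusSite 2 V)).filter fun q => c₀ * Ψ q ≠ 0).card : ℕ) : ℝ) ≤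
      (M : ℝ) * β * (V : ℝ) ^ 4 * CN := by
    rw [hCN]; push_cast
    calc 21 * (2 * (M : ℝ)) * (V : ℝ) ^ 2 * ((((univ : Finset (TorusSite 1 (2 * M) × TorusSite 2 V)).filter fun q => c₀ * Ψ q ≠ 0).card : ℕ) : ℝ)
        ≤ 21 * (2 * (M : ℝ)) * (V : ℝ) ^ 2 * (β * (V : ℝ) ^ 2 * (2 * ((Λ₁ / π + 3 / 128) * (1793 * Λ₁ + 704)))) :=
          mul_le_mul_of_nonneg_left hNs (by positivity)
      _ = _ := by ring
  have hWs : Real.sqrt (32768 * (1 / s₀ + 1) * ((1 + 4 * Real.sqrt 2) ^ 2 *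
      (4 * ((2 * Real.sqrt 2 / s₁ + 2) * (2 * Real.sqrt 2 / s₁ + 2))) + 16 * (1 / s₁ + 1) ^ 2)) ≤ Real.sqrt ((M : ℝ) / β) * x * Real.sqrt CW := by
    have e : Real.sqrt ((M : ℝ) / β) * x * Real.sqrt CW = Real.sqrt ((M : ℝ) / β * x ^ 2 * CW) := by
      rw [Real.sqrt_mul (by positivity) CW, Real.sqrt_mul (by positivity) (x ^ 2), Real.sqrt_sq hx0.le]
    rw [e]; exact Real.sqrt_le_sqrt hW
  have hNsq : Real.sqrt (21 * ((2 * M : ℕ) : ℝ) * (V : ℝ) ^ 2 * ((((univ : Finset (TorusSite 1 (2 * M) × TorusSite 2 V)).filter fun q => c₀ * Ψ q ≠ 0).card : ℕ) : ℝ)) ≤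
      Real.sqrt ((M : ℝ) * β) * (V : ℝ) ^ 2 * Real.sqrt CN := by
    have e : Real.sqrt ((M : ℝ) * β * (V : ℝ) ^ 4 * CN) = Real.sqrt ((M : ℝ) * β) * (V : ℝ) ^ 2 * Real.sqrt CN := by
      rw [show (M : ℝ) * β * (V : ℝ) ^ 4 * CN = ((M : ℝ) * β) * (((V : ℝ) ^ 2) ^ 2) * CN by ring,
        Real.sqrt_mul (by positivity) CN, Real.sqrt_mul (by positivity) (((V : ℝ) ^ 2) ^ 2), Real.sqrt_sq (by positivity)]
    rw [← e]; exact Real.sqrt_le_sqrt hN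
  have hMM : Real.sqrt ((M : ℝ) / β) * Real.sqrt ((M : ℝ) * β) = M := by
    rw [← Real.sqrt_mul (by positivity), show (M : ℝ) / β * ((M : ℝ) * β) = (M : ℝ) * M by field_simp, Real.sqrt_mul_self hM0.le]
  calc Real.sqrt (32768 * (1 / s₀ + 1) * ((1 + 4 * Real.sqrt 2) ^ 2 *
        (4 * ((2 * Real.sqrt 2 / s₁ + 2) * (2 * Real.sqrt 2 / s₁ + 2))) + 16 * (1 / s₁ + 1) ^ 2)) *
        Real.sqrt (21 * ((2 * M : ℕ) : ℝ) * (V : ℝ) ^ 2 * ((((univ : Finset (TorusSite 1 (2 * M) × TorusSite 2 V)).filter fun q => c₀ * Ψ q ≠ 0).card : ℕ) : ℝ)) * A₀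
      ≤ (Real.sqrt ((M : ℝ) / β) * x * Real.sqrt CW) * (Real.sqrt ((M : ℝ) * β) * (V : ℝ) ^ 2 * Real.sqrt CN) * A₀ := by gcongr
    _ = Real.sqrt CW * Real.sqrt CN * (D₁ / Λ₂ ^ 2) * ((Real.sqrt ((M : ℝ) / β) * Real.sqrt ((M : ℝ) * β)) / β) * (G₀ / x) := by
        rw [hA₀eq]; field_simp
    _ = Real.sqrt CW * Real.sqrt CN * (D₁ / Λ₂ ^ 2) * ((M : ℝ) / β) * (G₀ / x) := by rw [hMM]


end Summit.HubbardSuperconductivity.HubbardSuperconductivity.Theorems.TorusFourierL2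

end
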